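import Summits.BirchSwinnertonDyer.BirchSwinnertonDyer.Theorems.ManinLocalTwoThreeSL2OddPrimeNormalizer
import Literature.GroupTheory.CentralExtensionDicyclicTransfer
import Literature.GroupTheory.SpecificGroups.SL2OddPrimeStableCharacterExtension
import HarnessLib

set_option autoImplicit false
set_option linter.dupNamespace false

/-!
# F-es-27′ is a THEOREM: `sl2ZModOddPrime_existsUnique_extension_of_stable_character` holds — the registered stub
# `stub_sl2OddPrimeExtensionFact` of the line `kato_shift_two` (crux C2 `ManinOddAtFour`) PROVED BY NAME

Summit `BirchSwinnertonDyer`, route `ManinLocalTwoThree` (cell bsd-f2-manin), deciding crux C2 `ManinOddAtFour`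
(stmt-BirchSwinnertonDyer-22967), line `kato_shift_two` v8 (lead p1), registered stub
**`stub_sl2OddPrimeExtensionFact : sl2ZModOddPrime_existsUnique_extension_of_stable_character`** — the named Literature
fact F-es-27′ («EXT-CRIT», `Literature/GroupTheory/SpecificGroups/SL2OddPrimeStableCharacterExtension.lean`; a derived
reading of Fiedorowicz–Priddy 1978 VI.5.4 `H¹ = H² = 0` for `SL₂(𝔽_q)` mod `2`, `q` odd).  It is proved here WITHOUT
cohomology, by assembling

* the cell typer's abstract criterion `existsUnique_extension_of_stable_of_dicyclic_oddIndex`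
  (`Literature/GroupTheory/CentralExtensionDicyclicTransfer.lean`, p610848): a group `Q` generated by elements killed by an
  odd `q` and containing a dicyclic pair `(a, b)` (`b a b⁻¹ = a⁻¹`, `b² = a^k`, `k` even, `a` of order `2k`) generating a
  subgroup of ODD index satisfies EXT-CRIT (transfer to `⟨a, b⟩` + the dicyclic central-extension computation);
* this seat's `SL₂(𝔽_q)` data (`ManinLocalTwoThreeSL2OddPrimeSquareRoots.lean`, `…Normalizer.lean`), UNIFORM in the odd
  prime `q`: the torus `C(w)` of `w = (0 -1; 1 0)` is cyclic of order divisible by `4`, an element `j` inverting it exists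
  (all square roots of `-1` are conjugate) and squares to `-1`, and `N(⟨w⟩) = C(w) ∪ C(w) j = ⟨a, b⟩` has ODD index
  (Sylow argument) — `closure_pow_eq_one_eq_top`, `exists_dicyclic_oddIndex` below.

`sl2ZModOddPrime_existsUnique_extension_of_stable_character_holds` is the fact verbatim; `stub_sl2OddPrimeExtensionFact`
is the registered stub BY NAME.  HONEST FRAMING: this closes ONE of the five named inputs of the lead's conditional
reduction `maninOddAtFour_of_namedInputs`; nothing about BSD or the Manin constant is proved here.
-/

open scoped MatrixGroups

namespace Summit.BirchSwinnertonDyer.BirchSwinnertonDyer.Theorems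

namespace ManinLocalTwoThree.SL2ZModOddPrime

variable {q : ℕ} [Fact q.Prime]

/-- **`SL₂(𝔽_q)` is generated by its elements killed by `q`** (indeed by the elementary unipotents: every element is
`u l u'` or `l⁻¹ u l' u'` with `u, u'` upper and `l, l'` lower unipotent). [folklore] -/
theorem closure_pow_eq_one_eq_top : Subgroup.closure {g : SL(2, ZMod q) | g ^ q = 1} = ⊤ := by
  -- elementary unipotents and their `q`-th powers
  let U : ZMod q → SL(2, ZMod q) := fun a => ⟨!![1, a; 0, 1], by simp [Matrix.det_fin_two_of]⟩
  let L : ZMod q → SL(2, ZMod q) := fun a => ⟨!![1, 0; a, 1], by simp [Matrix.det_fin_two_of]⟩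
  have hU : ∀ a b, U a * U b = U (a + b) := fun a b => by
    ext i j
    fin_cases i <;> fin_cases j <;> simp [U, Matrix.mul_apply, Fin.sum_univ_two]
    ring
  have hL : ∀ a b, L a * L b = L (a + b) := fun a b => by
    ext i j
    fin_cases i <;> fin_cases j <;> simp [L, Matrix.mul_apply, Fin.sum_univ_two]
  have hUpow : ∀ (a : ZMod q) (n : ℕ), U a ^ n = U (n * a) := fun a n => by
    induction n with
    | zero => simp only [pow_zero, Nat.cast_zero, zero_mul]; ext i j; fin_cases i <;> fin_cases j <;> simp [U]
    | succ n ih => rw [pow_succ, ih, hU]; congr 1; push_cast; ring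
  have hLpow : ∀ (a : ZMod q) (n : ℕ), L a ^ n = L (n * a) := fun a n => by
    induction n with
    | zero => simp only [pow_zero, Nat.cast_zero, zero_mul]; ext i j; fin_cases i <;> fin_cases j <;> simp [L]
    | succ n ih => rw [pow_succ, ih, hL]; congr 1; push_cast; ring
  have hq0 : ((q : ℕ) : ZMod q) = 0 := ZMod.natCast_self q
  have hU0 : U 0 = 1 := by ext i j; fin_cases i <;> fin_cases j <;> simp [U]
  have hL0 : L 0 = 1 := by ext i j; fin_cases i <;> fin_cases j <;> simp [L]
  have hUS : ∀ a, U a ∈ Subgroup.closure {g : SL(2, ZMod q) | g ^ q = 1} := fun a =>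
    Subgroup.subset_closure (show U a ^ q = 1 by rw [hUpow, hq0, zero_mul, hU0])
  have hLS : ∀ a, L a ∈ Subgroup.closure {g : SL(2, ZMod q) | g ^ q = 1} := fun a =>
    Subgroup.subset_closure (show L a ^ q = 1 by rw [hLpow, hq0, zero_mul, hL0])
  -- elements with non-zero lower-left entry are `u l u'`
  have key : ∀ g : SL(2, ZMod q), g 1 0 ≠ 0 → g ∈ Subgroup.closure {g : SL(2, ZMod q) | g ^ q = 1} := by
    intro g hc
    have hdet := det_two g
    have e00 : (U ((g 0 0 - 1) / g 1 0) * L (g 1 0) * U ((g 1 1 - 1) / g 1 0)) 0 0 = g 0 0 := by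
      simp only [mul_apply_two]; simp [U, L]; field_simp; ring
    have e01 : (U ((g 0 0 - 1) / g 1 0) * L (g 1 0) * U ((g 1 1 - 1) / g 1 0)) 0 1 = g 0 1 := by
      simp only [mul_apply_two]; simp [U, L]; field_simp; linear_combination hdet
    have e10 : (U ((g 0 0 - 1) / g 1 0) * L (g 1 0) * U ((g 1 1 - 1) / g 1 0)) 1 0 = g 1 0 := by
      simp only [mul_apply_two]; simp [U, L]
    have e11 : (U ((g 0 0 - 1) / g 1 0) * L (g 1 0) * U ((g 1 1 - 1) / g 1 0)) 1 1 = g 1 1 := by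
      simp only [mul_apply_two]; simp [U, L]; field_simp; ring
    have hg : g = U ((g 0 0 - 1) / g 1 0) * L (g 1 0) * U ((g 1 1 - 1) / g 1 0) := by
      ext i j
      fin_cases i <;> fin_cases j
      · exact e00.symm
      · exact e01.symm
      · exact e10.symm
      · exact e11.symm
    rw [hg]
    exact Subgroup.mul_mem _ (Subgroup.mul_mem _ (hUS _) (hLS _)) (hUS _)
  rw [eq_top_iff]
  intro g _
  by_cases hc : g 1 0 = 0
  · have hdet := det_two g
    rw [hc, mul_zero, sub_zero] at hdet
    have ha : g 0 0 ≠ 0 := fun h0 => by rw [h0, zero_mul] at hdet; exact zero_ne_one hdet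
    have h1 : L 1 * g ∈ Subgroup.closure {g : SL(2, ZMod q) | g ^ q = 1} :=
      key (L 1 * g) (by simpa [mul_apply_two, L, hc] using ha)
    have : g = (L 1)⁻¹ * (L 1 * g) := by group
    rw [this]
    exact Subgroup.mul_mem _ (Subgroup.inv_mem _ (hLS 1)) h1
  · exact key g hc

/-- **An odd-index dicyclic pair in `SL₂(𝔽_q)`, `q` an odd prime**, uniformly in `q`: a generator `a` of the cyclic torus
`C(w)` of `w = (0 -1; 1 0)` and an element `b` inverting it, with `b² = a^k = -1`, `k = ord(a)/2` even, and
`⟨a, b⟩ = N(⟨w⟩)` of odd index (the dicyclic subgroups `Q_{2(q∓1)}` of Brown VI.9 Exercise 8). [folklore] -/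
theorem exists_dicyclic_oddIndex (hq : q ≠ 2) :
    ∃ (a b : SL(2, ZMod q)) (k : ℕ), Even k ∧ b * a * b⁻¹ = a⁻¹ ∧ b ^ 2 = a ^ k ∧
      (∀ m : ℕ, a ^ (2 * m) = 1 → k ∣ m) ∧ Odd (Subgroup.closure ({a, b} : Set (SL(2, ZMod q)))).index := by
  classical
  let w : SL(2, ZMod q) := ⟨!![0, -1; 1, 0], by simp [Matrix.det_fin_two_of]⟩
  have hw : (w : Matrix (Fin 2) (Fin 2) (ZMod q)) = !![0, -1; 1, 0] := rfl
  have hs : w * w = -1 := mul_self_w hw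
  have hs' : w⁻¹ * w⁻¹ = -1 := by rw [inv_eq_neg hs]; simpa using hs
  obtain ⟨j, hj⟩ := exists_conj_eq_of_mul_self_eq_neg_one hq w w⁻¹ hs hs'
  have hj2 : j * j = -1 := mul_self_eq_neg_one_of_conj_w_eq_inv hw j hj
  have hinv := conj_eq_inv_of_mem_centralizer_w hw j hj
  haveI := isCyclic_centralizer_w hq hw
  obtain ⟨c₀, hC⟩ := (Subgroup.isCyclic_iff_exists_zpowers_eq_top
    (Subgroup.centralizer ({w} : Set (SL(2, ZMod q))))).1 inferInstance
  have hc₀ : c₀ ∈ Subgroup.centralizer ({w} : Set (SL(2, ZMod q))) := by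
    rw [← hC]; exact Subgroup.mem_zpowers c₀
  have h4 : 4 ∣ orderOf c₀ := by
    rw [← Nat.card_zpowers, hC]; exact four_dvd_card_centralizer hq hs
  obtain ⟨k, hk⟩ := h4
  have hkpos : 0 < k := by
    rcases Nat.eq_zero_or_pos k with h0 | h0
    · exfalso; rw [h0, mul_zero] at hk; exact (orderOf_pos c₀).ne' hk
    · exact h0
  -- `c₀ ^ (2k) = -1`
  have hck : c₀ ^ (2 * k) = -1 := by
    have hne : c₀ ^ (2 * k) ≠ 1 := pow_ne_one_of_lt_orderOf (by omega) (by rw [hk]; omega)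
    have hsq1 : c₀ ^ (2 * k) * c₀ ^ (2 * k) = 1 := by
      rw [← pow_add, show 2 * k + 2 * k = orderOf c₀ by rw [hk]; ring, pow_orderOf_eq_one]
    rcases eq_one_or_eq_neg_one_of_mul_self_eq_one hq _ hsq1 with h | h
    · exact absurd h hne
    · exact h
  refine ⟨c₀, j, 2 * k, even_two_mul k, hinv c₀ hc₀, by rw [pow_two, hj2, hck], fun m hm => ?_, ?_⟩
  · -- `c₀ ^ (2m) = 1 ⇒ 4k ∣ 2m ⇒ 2k ∣ m`
    have hdvd : orderOf c₀ ∣ 2 * m := orderOf_dvd_of_pow_eq_one hm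
    rw [hk] at hdvd
    obtain ⟨r, hr⟩ := hdvd
    exact ⟨r, Nat.eq_of_mul_eq_mul_left (by norm_num : 0 < 2) (by rw [hr]; ring)⟩
  · -- `⟨c₀, j⟩ = N(⟨w⟩)`, which has odd index
    have hjw : j⁻¹ * w * j = w⁻¹ := by
      have h1 := hinv w (Subgroup.mem_centralizer_singleton_iff.2 rfl)
      have h2 : j * w⁻¹ * j⁻¹ = w := by
        have := congrArg (·⁻¹) h1
        simpa only [mul_inv_rev, inv_inv, mul_assoc] using this
      calc j⁻¹ * w * j = j⁻¹ * (j * w⁻¹ * j⁻¹) * j := by rw [h2]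
        _ = w⁻¹ := by group
    have heq : Subgroup.closure ({c₀, j} : Set (SL(2, ZMod q))) =
        Subgroup.normalizer (Subgroup.zpowers w : Set (SL(2, ZMod q))) := by
      apply le_antisymm
      · rw [Subgroup.closure_le]
        rintro x (rfl | rfl)
        · rw [SetLike.mem_coe, mem_normalizer_zpowers_iff hq hs]
          left
          rw [mul_inv_eq_iff_eq_mul]
          exact Subgroup.mem_centralizer_singleton_iff.1 hc₀
        · rw [SetLike.mem_coe, mem_normalizer_zpowers_iff hq hs]
          right; exact hj
      · intro g hg
        rw [mem_normalizer_zpowers_iff hq hs] at hg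
        have hc₀mem : c₀ ∈ Subgroup.closure ({c₀, j} : Set (SL(2, ZMod q))) := Subgroup.subset_closure (by simp)
        have hjmem : j ∈ Subgroup.closure ({c₀, j} : Set (SL(2, ZMod q))) := Subgroup.subset_closure (by simp)
        have hCle : Subgroup.zpowers c₀ ≤ Subgroup.closure ({c₀, j} : Set (SL(2, ZMod q))) := by
          rw [Subgroup.zpowers_le]; exact hc₀mem
        rcases hg with h | h
        · apply hCle
          rw [hC, Subgroup.mem_centralizer_singleton_iff, ← mul_inv_eq_iff_eq_mul, h]
        · have hmem : g * j⁻¹ ∈ Subgroup.zpowers c₀ := by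
            rw [hC, Subgroup.mem_centralizer_singleton_iff, ← mul_inv_eq_iff_eq_mul]
            calc g * j⁻¹ * w * (g * j⁻¹)⁻¹ = g * (j⁻¹ * w * j) * g⁻¹ := by group
              _ = g * w⁻¹ * g⁻¹ := by rw [hjw]
              _ = (g * w * g⁻¹)⁻¹ := by group
              _ = w := by rw [h, inv_inv]
          have : g = g * j⁻¹ * j := by group
          rw [this]
          exact Subgroup.mul_mem _ (hCle hmem) hjmem
    rw [heq]
    exact Nat.odd_iff.2 (Nat.two_dvd_ne_zero.1 (not_two_dvd_index_normalizer_zpowers hq hs))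

end ManinLocalTwoThree.SL2ZModOddPrime

open ManinLocalTwoThree.SL2ZModOddPrime Literature.GroupTheory.SpecificGroups
  Literature.GroupTheory.CentralExtensionDicyclic

/-- **F-es-27′ holds: the extension criterion EXT-CRIT for `SL₂(𝔽_q)`, `q` an odd prime, `2`-torsion coefficients.**
For every odd prime `q`, every surjection `π : G ↠ SL(2, ZMod q)`, every abelian group `K` with `y + y = 0`, and every
`G`-stable additive `ψ : ker π → K`, there is a unique additive `Ψ : G → K` restricting to `ψ` — the statement of the named
Literature fact `sl2ZModOddPrime_existsUnique_extension_of_stable_character` (derived reading of Fiedorowicz–Priddy 1978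
VI.5.4), proved by the transfer to the odd-index dicyclic normaliser `N(⟨w⟩)` and the dicyclic central-extension
computation (no cohomology).
[cite: FiedorowiczPriddy1978, Ch. VI Prop. 5.4; Brown1982CohomologyGroups, VI.9 Exercise 8 (dicyclic subgroups of SL_2(F_q) of odd index)] -/
theorem sl2ZModOddPrime_existsUnique_extension_of_stable_character_holds :
    sl2ZModOddPrime_existsUnique_extension_of_stable_character := by
  intro q hq hq2 G _ π hπ K _ hK ψ hψ hst
  haveI : Fact q.Prime := ⟨hq⟩
  have hqodd : Odd q := hq.odd_of_ne_two hq2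
  obtain ⟨a, b, k, hk, hab, hb2, hak, hidx⟩ := exists_dicyclic_oddIndex (q := q) hq2
  exact existsUnique_extension_of_stable_of_dicyclic_oddIndex hqodd (closure_pow_eq_one_eq_top (q := q))
    (fun s hs => hs) hk hab hb2 hak hidx π hπ hK ψ hψ hst

/-- **The registered stub `stub_sl2OddPrimeExtensionFact` of the line `kato_shift_two` (crux `ManinOddAtFour`,
stmt-BirchSwinnertonDyer-22967) PROVED BY NAME** — F-es-27′ is a theorem. [folklore] -/
theorem stub_sl2OddPrimeExtensionFact : sl2ZModOddPrime_existsUnique_extension_of_stable_character :=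
  sl2ZModOddPrime_existsUnique_extension_of_stable_character_holds

end Summit.BirchSwinnertonDyer.BirchSwinnertonDyer.Theorems
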